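import Summits.AtomisticToContinuum.BoseEinsteinCondensation.Theorems.BECSubharmonicContinuationCoreContinuationBallSlices
import Mathlib.MeasureTheory.Integral.IntervalIntegral.IntegrationByParts
import Mathlib.MeasureTheory.Integral.Average
import HarnessLib

/-!
# Route `BECSubharmonicContinuation` — the ball Green kernel against plane waves, II: the per-mode
# Green identity (helper for `CoreContinuation`, stmt-AtomisticToContinuum-14570)

For every wave vector `k ∈ ℝ³` and radius `S > 0`,

`|k|² ∫_{B(0,S)} cos(k·y) K_S(|y|) dy = 1 - ⨍_{B(0,S)} cos(k·y) dy`,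
`K_S(s) = (4π)⁻¹ (1/s - 3/(2S) + s²/(2S³))`

(`norm_sq_mul_integral_ball_cos_mul_ballKernel`): Green's representation formula on the ball for
the plane wave `u = cos(k·y)` (`-Δu = |k|²u`, `u(0) = 1`; `K_S` is the Green kernel with
`K_S = ∂ₙK_S = 0` on the sphere, so no boundary terms), which summed over the momentum
distribution of a periodic state is the harmonic-minorant identity `1 - ⨍_{B_S} G = ∫_{B_S} H K_S`
of the route. Proof without closed forms and without the divergence theorem: a Householder
reflection puts `k` on the axis `e₂` (`setIntegral_ball_inner_eq_axial`), the slice file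
`…CoreContinuationBallSlices.lean` turns both ball integrals into height integrals, and the
remaining identity
`κ² · ½∫_{-S}^{S} cos(κt)P(|t|) dt + (3/(4S³))∫_{-S}^{S} cos(κt)(S² - t²) dt = 1`,
`P(u) = 3S/8 - u + 3u²/(4S) - u⁴/(8S³)` (`P(S) = P′(S) = 0`, `P′(0) = -1`, `P″ = (3/(2S³))(S² - u²)`)
is one fundamental theorem of calculus per half-interval (`axial_oneDim_identity`).

## References

* D. Gilbarg, N. S. Trudinger, *Elliptic Partial Differential Equations of Second Order*,
  Springer 2001, §2.4–2.5 (Green's representation, Green's function of the ball). [GilbargTrudinger2001]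
-/

noncomputable section

open MeasureTheory Set Real Metric
open scoped BigOperators RealInnerProductSpace

namespace Summit.AtomisticToContinuum.BoseEinsteinCondensation.Theorems.CoreContinuationKernel

open Literature.Analysis.FluidPDE
open Literature.MathematicalPhysics.QuantumManyBody.BoseGas (Space)
open Summit.AtomisticToContinuum.BoseEinsteinCondensation.Theorems.CoreDeficitBounds

/-! ### The one-variable identity -/

/-- **The one-variable identity behind the ball Green formula.** With
`V(t) = (S - |t|) - (3/(4S))(S² - t²) + (S⁴ - t⁴)/(8S³) = P(|t|)`,
`P(u) = 3S/8 - u + 3u²/(4S) - u⁴/(8S³)` (`P(S) = P′(S) = 0`, `P′(0) = -1`,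
`P″(u) = (3/(2S³))(S² - u²)`):
`κ² · ½∫_{-S}^{S} cos(κt) V(t) dt + (3/(4S³)) ∫_{-S}^{S} cos(κt)(S² - t²) dt = 1`
(on each half-interval `½(P κ sin(κt) ± P′ cos(κt))` is an antiderivative of the integrand).
[folklore] -/
theorem axial_oneDim_identity (κ : ℝ) {S : ℝ} (hS : 0 < S) :
    κ ^ 2 * (1 / 2 * ∫ t in (-S)..S, Real.cos (κ * t) *
        ((S - |t|) - 3 / (4 * S) * (S ^ 2 - t ^ 2) + (S ^ 4 - t ^ 4) / (8 * S ^ 3))) +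
      3 / (4 * S ^ 3) * ∫ t in (-S)..S, Real.cos (κ * t) * (S ^ 2 - t ^ 2) = 1 := by
  have hS0 : S ≠ 0 := hS.ne'
  -- the polynomial `P` and its derivative
  set P : ℝ → ℝ := fun u => 3 * S / 8 - u + 3 * u ^ 2 / (4 * S) - u ^ 4 / (8 * S ^ 3) with hP
  set P' : ℝ → ℝ := fun u => -1 + 3 * u / (2 * S) - u ^ 3 / (2 * S ^ 3) with hP'
  -- the combined integrand
  set E : ℝ → ℝ := fun t => κ ^ 2 * (1 / 2 * (Real.cos (κ * t) *
      ((S - |t|) - 3 / (4 * S) * (S ^ 2 - t ^ 2) + (S ^ 4 - t ^ 4) / (8 * S ^ 3)))) +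
      3 / (4 * S ^ 3) * (Real.cos (κ * t) * (S ^ 2 - t ^ 2)) with hE
  have hEc : Continuous E := by
    rw [hE]
    fun_prop
  have hcomb : κ ^ 2 * (1 / 2 * ∫ t in (-S)..S, Real.cos (κ * t) *
        ((S - |t|) - 3 / (4 * S) * (S ^ 2 - t ^ 2) + (S ^ 4 - t ^ 4) / (8 * S ^ 3))) +
      3 / (4 * S ^ 3) * ∫ t in (-S)..S, Real.cos (κ * t) * (S ^ 2 - t ^ 2) = ∫ t in (-S)..S, E t := by
    rw [hE, intervalIntegral.integral_add (Continuous.intervalIntegrable (by fun_prop) _ _)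
      (Continuous.intervalIntegrable (by fun_prop) _ _), intervalIntegral.integral_const_mul,
      intervalIntegral.integral_const_mul, intervalIntegral.integral_const_mul]
  rw [hcomb, ← intervalIntegral.integral_add_adjacent_intervals (b := 0)
    (hEc.intervalIntegrable _ _) (hEc.intervalIntegrable _ _)]
  -- the right half `[0, S]`: antiderivative `½ (P(t) κ sin(κt) + P'(t) cos(κt))`
  have hright : ∫ t in (0 : ℝ)..S, E t = 1 / 2 := by
    set Φ : ℝ → ℝ := fun t => 1 / 2 * (P t * κ * Real.sin (κ * t) + P' t * Real.cos (κ * t)) with hΦ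
    have hderiv : ∀ t ∈ uIcc (0 : ℝ) S, HasDerivAt Φ (E t) t := by
      intro t ht
      rw [uIcc_of_le hS.le, mem_Icc] at ht
      have habs : |t| = t := abs_of_nonneg ht.1
      have hd : DifferentiableAt ℝ Φ t := by rw [hΦ, hP, hP']; fun_prop
      refine hd.hasDerivAt.congr_deriv ?_
      rw [hE]
      simp only [habs]
      rw [hΦ, hP, hP']
      simp (disch := fun_prop)
      field_simp
      ring
    rw [intervalIntegral.integral_eq_sub_of_hasDerivAt hderiv (hEc.intervalIntegrable _ _), hΦ, hP, hP']
    simp only [mul_zero, Real.sin_zero, Real.cos_zero, mul_one]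
    field_simp
    ring
  -- the left half `[-S, 0]`: antiderivative `½ (P(-t) κ sin(κt) - P'(-t) cos(κt))`
  have hleft : ∫ t in (-S)..(0 : ℝ), E t = 1 / 2 := by
    set Φ : ℝ → ℝ := fun t => 1 / 2 * (P (-t) * κ * Real.sin (κ * t) - P' (-t) * Real.cos (κ * t))
      with hΦ
    have hderiv : ∀ t ∈ uIcc (-S) (0 : ℝ), HasDerivAt Φ (E t) t := by
      intro t ht
      rw [uIcc_of_le (by linarith : -S ≤ 0), mem_Icc] at ht
      have habs : |t| = -t := abs_of_nonpos ht.2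
      have hd : DifferentiableAt ℝ Φ t := by rw [hΦ, hP, hP']; fun_prop
      refine hd.hasDerivAt.congr_deriv ?_
      rw [hE]
      simp only [habs]
      rw [hΦ, hP, hP']
      simp (disch := fun_prop)
      field_simp
      ring
    rw [intervalIntegral.integral_eq_sub_of_hasDerivAt hderiv (hEc.intervalIntegrable _ _), hΦ, hP, hP']
    simp only [mul_zero, Real.sin_zero, Real.cos_zero, mul_one, neg_zero, neg_neg, mul_neg,
      Real.sin_neg, Real.cos_neg]
    field_simp
    ring
  rw [hleft, hright]
  norm_num

/-! ### The general plane wave: reflection onto the axis -/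

/-- **Rotating the phase to the axis `e₂`**: for any `F`,
`∫_{|y|<S} F(⟪k,y⟫, |y|) dy = ∫_{|y|<S} F(|k| y₂, |y|) dy` (a Householder reflection exchanging the
directions of `k` and `e₂`; Lebesgue measure and the ball are invariant). [folklore] -/
theorem setIntegral_ball_inner_eq_axial (k : Space) (S : ℝ) (F : ℝ → ℝ → ℝ) :
    ∫ y in ball (0 : Space) S, F ⟪k, y⟫ ‖y‖ = ∫ y in ball (0 : Space) S, F (‖k‖ * y 2) ‖y‖ := by
  set e : Space := EuclideanSpace.single 2 (1 : ℝ) with he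
  have hke : ‖k‖ = ‖(‖k‖ : ℝ) • e‖ := by
    rw [norm_smul, he, PiLp.norm_single, norm_one, mul_one, Real.norm_of_nonneg (norm_nonneg _)]
  set T : Space ≃ₗᵢ[ℝ] Space := ((ℝ ∙ (k - ‖k‖ • e))ᗮ).reflection with hT
  have hTk : T k = ‖k‖ • e := Submodule.reflection_sub hke
  have hT' : ∀ y : Space, ⟪k, y⟫ = ‖k‖ * (T y) 2 := fun y =>
    calc ⟪k, y⟫ = ⟪T k, T y⟫ := (T.inner_map_map k y).symm
      _ = ‖k‖ * (T y) 2 := by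
          rw [hTk, real_inner_smul_left, he, EuclideanSpace.inner_single_left, map_one, one_mul]
  have hmp : MeasurePreserving T volume volume := T.measurePreserving
  have hpre : T ⁻¹' ball (0 : Space) S = ball 0 S := by
    rw [LinearIsometryEquiv.preimage_ball, map_zero]
  have h := hmp.setIntegral_preimage_emb T.toMeasurableEquiv.measurableEmbedding
    (fun y => F (‖k‖ * y 2) ‖y‖) (ball (0 : Space) S)
  rw [hpre] at h
  rw [← h]
  refine setIntegral_congr_fun measurableSet_ball fun y _ => ?_
  simp only [hT' y, LinearIsometryEquiv.norm_map]

/-- `|B(0, S)| = 4πS³/3` in `ℝ³` (`S ≥ 0`). [folklore] -/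
theorem volume_real_ball {S : ℝ} (hS : 0 ≤ S) :
    (volume : Measure Space).real (ball (0 : Space) S) = 4 * π * S ^ 3 / 3 := by
  rw [Measure.real, EuclideanSpace.volume_ball_fin_three, ENNReal.toReal_mul, ENNReal.toReal_pow,
    ENNReal.toReal_ofReal hS, ENNReal.toReal_ofReal (by positivity)]
  ring

/-- **The ball Green kernel identity, per mode.** For every `k ∈ ℝ³` and `S > 0`,
`|k|² ∫_{B(0,S)} cos(k·y) K_S(|y|) dy = 1 - ⨍_{B(0,S)} cos(k·y) dy` with the ball kernel
`K_S(s) = (4π)⁻¹(1/s - 3/(2S) + s²/(2S³))`, i.e. `∫_{B_S} (-Δ cos(k·y)) K_S = cos(k·0) - ⨍_{B_S} cos(k·y)`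
(Green's representation on the ball for the plane wave, `K_S = ∂ₙK_S = 0` on the sphere; proved
here by rotating `k` to an axis, slicing the ball into discs, and the one-variable identity
`axial_oneDim_identity` — no closed forms needed; `k = 0` is allowed). [folklore] -/
theorem norm_sq_mul_integral_ball_cos_mul_ballKernel (k : Space) {S : ℝ} (hS : 0 < S) :
    ‖k‖ ^ 2 * ∫ y in ball (0 : Space) S, Real.cos (∑ j, k j * y j) *
        ((4 * π)⁻¹ * (‖y‖⁻¹ - 3 / (2 * S) + ‖y‖ ^ 2 / (2 * S ^ 3))) =
      1 - ⨍ y in ball (0 : Space) S, Real.cos (∑ j, k j * y j) := by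
  simp_rw [sum_mul_eq_inner]
  set κ : ℝ := ‖k‖ with hκ
  -- rotate to the axis
  have h1 : ∫ y in ball (0 : Space) S, Real.cos ⟪k, y⟫ *
      ((4 * π)⁻¹ * (‖y‖⁻¹ - 3 / (2 * S) + ‖y‖ ^ 2 / (2 * S ^ 3))) =
      (4 * π)⁻¹ * ∫ y in ball (0 : Space) S, Real.cos (κ * y 2) *
        (‖y‖⁻¹ - 3 / (2 * S) + ‖y‖ ^ 2 / (2 * S ^ 3)) := by
    rw [setIntegral_ball_inner_eq_axial k S (fun a s => Real.cos a *
      ((4 * π)⁻¹ * (s⁻¹ - 3 / (2 * S) + s ^ 2 / (2 * S ^ 3)))), ← MeasureTheory.integral_const_mul]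
    refine setIntegral_congr_fun measurableSet_ball fun y _ => ?_
    ring
  have h2 : (⨍ y in ball (0 : Space) S, Real.cos ⟪k, y⟫) =
      (4 * π * S ^ 3 / 3)⁻¹ * ∫ y in ball (0 : Space) S, Real.cos (κ * y 2) := by
    rw [setAverage_eq, volume_real_ball hS.le, smul_eq_mul,
      setIntegral_ball_inner_eq_axial k S (fun a _ => Real.cos a)]
  rw [h1, h2, integral_ball_cos_axial_mul_ballKernel κ hS, integral_ball_cos_axial κ hS]
  have hid := axial_oneDim_identity κ hS
  have hπ : π ≠ 0 := Real.pi_pos.ne'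
  have hS0 : S ≠ 0 := hS.ne'
  -- `∫ cos(κt) π(S² - t²) = π ∫ cos(κt)(S² - t²)`
  have h3 : ∫ t in (-S)..S, Real.cos (κ * t) * (π * (S ^ 2 - t ^ 2)) =
      π * ∫ t in (-S)..S, Real.cos (κ * t) * (S ^ 2 - t ^ 2) := by
    rw [← intervalIntegral.integral_const_mul]
    refine intervalIntegral.integral_congr fun t _ => ?_
    ring
  rw [h3]
  set I₁ := ∫ t in (-S)..S, Real.cos (κ * t) *
    ((S - |t|) - 3 / (4 * S) * (S ^ 2 - t ^ 2) + (S ^ 4 - t ^ 4) / (8 * S ^ 3)) with hI₁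
  set I₂ := ∫ t in (-S)..S, Real.cos (κ * t) * (S ^ 2 - t ^ 2) with hI₂
  have e1 : κ ^ 2 * ((4 * π)⁻¹ * (2 * π * I₁)) = κ ^ 2 * (1 / 2 * I₁) := by
    field_simp
    ring
  have e2 : (4 * π * S ^ 3 / 3)⁻¹ * (π * I₂) = 3 / (4 * S ^ 3) * I₂ := by
    field_simp
  rw [e1, e2]
  linarith

end Summit.AtomisticToContinuum.BoseEinsteinCondensation.Theorems.CoreContinuationKernel

end
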